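import Summits.BirchSwinnertonDyer.Rank1Residual.P2.CMKolyvaginHabitatTamagawaCubeSums
import Summits.BirchSwinnertonDyer.Rank1Residual.P2.CMKolyvaginHabitatImageAtTwo
import Summits.BirchSwinnertonDyer.Rank1Residual.P2.CMKolyvaginHabitatManinAtTwo
import Summits.BirchSwinnertonDyer.Rank1Residual.P2.CornerFTwoModelClasses
import Literature.NumberTheory.EllipticCurves.LFunctionPrimeCoeff
import HarnessLib

/-!
# Route `CMKolyvaginAtInertTwo` (leaf `WAllCornerFTwo`): the CUBE-SUM FAMILY against the habitat `H₂`
# — every arithmetic binder decided by `n mod 9` and the parity of `n` (assembly, by name)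

Cell `bsd-print-cf2`, seat ty2 (discharge interface), line `route-BirchSwinnertonDyer-CMKolyvaginAtInertTwo`
(items stmt-BirchSwinnertonDyer-22835 `CMPrimitiveSupplyAtInertTwo`, 22836 `CMKolyvaginExactAtInertTwo`,
residual 22838 `OffHabitatCMResidualAtTwo`). HONEST FRAMING: THEOREMS ONLY — no definition, no named
fact, no route file imported, nothing about BSD asserted or booked; the leaf is OPEN. The items quantify
over `W` in the habitat

  `H₂(W) : W.HasCM ∧ CMInert W 2 ∧ W.HasSurjectiveModNGaloisRep 2 ∧ Odd W.tamagawaProduct ∧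
          (∃ Dt, Λ_E ⊆ c·Λ_f ∧ Odd c)`   (+ `W.analyticRank = 1`, + the field / `M₀` binders),

and this file says, for EVERY model `W` of a cube-sum curve `E_n : x³ + y³ = n` (`n` cube-free), which
of these hold — by name, from the seat's files `CMKolyvaginHabitatImageAtTwo` (ρ̄₂),
`CMKolyvaginHabitatTamagawaCubeSums` (∏ c_ℓ), `CMKolyvaginHabitatManinAtTwo` (Manin, modulo Abbes–Ullmo)
and the tree's `CornerFTwoModelClasses` (CM, `2` inert):

* `hasCM_and_cmInert_two_of_model` — CM by `ℤ[ζ₃]`, `2` inert: ALWAYS;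
* `arithmeticHabitat_of_model_of_odd` — `n` odd, `n ≢ ±2 (mod 9)`: CM ∧ inert ∧ ρ̄₂ onto ∧ `Odd ∏ c_ℓ`;
* `hasGoodReductionAtPrime_two_of_model_of_odd` — `n` odd: good at `2`, whence
  `maninBinder_of_model_of_odd` — the Manin binder from "`W` optimal" alone, modulo `hAU`;
* `not_arithmeticHabitat_of_model_of_emod_nine` — `n ≡ ±2 (mod 9)`: `Odd ∏ c_ℓ` FAILS (`c₃ = 2`), so
  these curves (e.g. the Sylvester primes `p ≡ 2, 7 (mod 9)`) lie in the residual 22838, whatever the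
  other binders.

What is NOT decided here: `W.analyticRank = 1` (the genuine hypothesis), optimality of `W` (the Manin
binder's first clause), and for EVEN `n` the image binder (`n ≠ 2`: onto, `CMKolyvaginHabitatImageAtTwo`)
is not repackaged. References: the four files named above; [SilvermanATAEC1994] IV.9.4; [Rizzo2003]
Table II; [DokchitserDokchitserMathZ2012] Thm. (1); [AbbesUllmo1996] Thm. A; [Cox2013] §9.A.
-/

set_option autoImplicit false

noncomputable section

open scoped Classical NumberField

open WeierstrassCurve NumberField IsDedekindDomain IsDedekindDomain.HeightOneSpectrum
  Rat.HeightOneSpectrum Literature.NumberTheory.EllipticCurves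
  Literature.NumberTheory.EllipticCurves.HuShuYin2019
  Literature.NumberTheory.EllipticCurves.Rank1Residual
  Literature.NumberTheory.EllipticCurves.ModularForms
  Literature.NumberTheory.DiophantineGeometry

namespace Summit.BirchSwinnertonDyer.Rank1Residual.P2.CubeSum

variable (W : WeierstrassCurve ℚ) [W.IsElliptic] {n : ℤ}

omit [W.IsElliptic] in
/-- A model `W = C • E_n` in the shape `∃ C', C' • W = E_n` used by the local-type files. [folklore] -/
theorem exists_smul_eq_cubeSumCurve {C : VariableChange ℚ} (hC : C • cubeSumCurve (n : ℚ) = W) :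
    ∃ C' : VariableChange ℚ, C' • W = cubeSumCurve (n : ℚ) :=
  ⟨C⁻¹, by rw [← hC, inv_smul_smul]⟩

/-- **Every model of a cube-sum curve has CM (by `ℤ[ζ₃]`, `j = 0`) with `2` INERT in `ℚ(√−3)`.**
(`CornerFTwoModelClasses.hasCM_and_cmInert_two_of_smul_sextic`.) [cite: Cox2013, §9.A and Cor. 5.17] -/
theorem hasCM_and_cmInert_two_of_model (hn : n ≠ 0) {C : VariableChange ℚ}
    (hC : C • cubeSumCurve (n : ℚ) = W) : W.HasCM ∧ CMInert W 2 :=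
  CornerFTwo.hasCM_and_cmInert_two_of_smul_sextic (W := W) (B := -432 * (n : ℚ) ^ 2)
    (mul_ne_zero (by norm_num) (pow_ne_zero _ (by exact_mod_cast hn))) hC

/-- **The ARITHMETIC habitat binders on the cube-sum family, `n` odd, cube-free, `n ≢ ±2 (mod 9)`:**
every model `W` of `E_n` has CM with `2` inert, `ρ̄_{E,2}` onto and `∏_ℓ c_ℓ` odd.
[cite: DokchitserDokchitserMathZ2012, Thm. (1)] [cite: SilvermanATAEC1994, IV.9.4 and Table 4.1]
[cite: Rizzo2003, Table II (p. 4)] [cite: Cox2013, §9.A] -/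
theorem arithmeticHabitat_of_model_of_odd (hodd : Odd n)
    (hcf : ∀ p : ℕ, p.Prime → ¬ (p : ℤ) ^ 3 ∣ n) (h9 : ¬ (n % 9 = 2 ∨ n % 9 = 7))
    {C : VariableChange ℚ} (hC : C • cubeSumCurve (n : ℚ) = W) :
    W.HasCM ∧ CMInert W 2 ∧ W.HasSurjectiveModNGaloisRep 2 ∧ Odd W.tamagawaProduct := by
  have hn : n ≠ 0 := ne_zero_of_odd hodd
  obtain ⟨hCM, hin⟩ := hasCM_and_cmInert_two_of_model W hn hC
  exact ⟨hCM, hin, hasSurjectiveModNGaloisRep_two_of_smul_cubeSumCurve_of_odd W hodd hC,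
    odd_tamagawaProduct_of_model W hn hcf (exists_smul_eq_cubeSumCurve W hC) h9⟩

/-- **`n ≡ ±2 (mod 9)`: the habitat's Tamagawa binder fails for every model of `E_n`** (`c₃ = 2`), so
the conjunction `CMInert ∧ ρ̄₂ onto ∧ Odd ∏c ∧ Manin` fails — these cube sums are residual (item 22838).
[cite: Rizzo2003, Table II (p. 4)] [cite: SilvermanATAEC1994, IV.9.4 Step 9] -/
theorem not_arithmeticHabitat_of_model_of_emod_nine (hn : n ≠ 0)
    (hcf : ∀ p : ℕ, p.Prime → ¬ (p : ℤ) ^ 3 ∣ n) (h9 : n % 9 = 2 ∨ n % 9 = 7)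
    {C : VariableChange ℚ} (hC : C • cubeSumCurve (n : ℚ) = W) {P Q R : Prop} :
    ¬ (P ∧ Q ∧ Odd W.tamagawaProduct ∧ R) :=
  fun h => not_odd_tamagawaProduct_of_model W hn hcf (exists_smul_eq_cubeSumCurve W hC) h9 h.2.2.1

omit [W.IsElliptic] in
/-- **`n` odd: every model of `E_n` has good reduction at the prime `2`** (prime-indexed form of
`hasGoodReductionAt_two_of_model_of_odd`). [cite: SilvermanAEC2009, VII.5 Prop. 5.1 (a)] -/
theorem hasGoodReductionAtPrime_two_of_model_of_odd (hodd : Odd n) {C : VariableChange ℚ}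
    (hC : C • cubeSumCurve (n : ℚ) = W) : W.HasGoodReductionAtPrime 2 := by
  set v₂ : HeightOneSpectrum (𝓞 ℚ) := (primesEquiv (R := 𝓞 ℚ)).symm ⟨2, Nat.prime_two⟩ with hv₂
  have hv : natGenerator v₂ = 2 := by
    show ((primesEquiv v₂ : Nat.Primes) : ℕ) = 2
    rw [hv₂, Equiv.apply_symm_apply]
  exact (hasGoodReductionAtPrime_primesEquiv_iff_holds W v₂ 2 hv).mpr
    (hasGoodReductionAt_two_of_model_of_odd W v₂ hodd (exists_smul_eq_cubeSumCurve W hC) hv)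

/-- **`n` odd: the habitat's MANIN binder for a globally minimal model `W` of `E_n` is "`W` optimal"**,
modulo Abbes–Ullmo (`2 ∤ N_W` as `W` is good at `2`). [cite: AbbesUllmo1996, Thm. A] -/
theorem maninBinder_of_model_of_odd [W.IsGloballyMinimal] [NeZero (W.conductorNorm ℤ)]
    (hAU : abbesUllmo_not_dvd_maninConstant_of_not_dvd_level) (hodd : Odd n)
    {C : VariableChange ℚ} (hC : C • cubeSumCurve (n : ℚ) = W)
    (hopt : ∃ Dt : ModularParametrizationData W (W.conductorNorm ℤ), ShuZhai2021.IsOptimalDatum W Dt) :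
    ∃ Dt : ModularParametrizationData W (W.conductorNorm ℤ),
      (∀ z ∈ Dt.L.lattice, ∃ w ∈ periodLattice Dt.f, z = (Dt.c : ℂ) * w) ∧ Odd Dt.c :=
  maninBinder_of_exists_isOptimalDatum_of_hasGoodReductionAtPrime_two W hAU
    (hasGoodReductionAtPrime_two_of_model_of_odd W hodd hC) hopt

/-- **THE CUBE-SUM FAMILY IN `H₂` (all binders but the analytic rank), `n` odd cube-free,
`n ≢ ±2 (mod 9)`:** for a globally minimal OPTIMAL model `W` of `E_n`, modulo Abbes–Ullmo:
`CMInert W 2 ∧ ρ̄₂ onto ∧ Odd ∏c ∧ (∃ Dt, Λ_E ⊆ c·Λ_f ∧ Odd c)` — the literal hypothesis block of items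
22835/22836 after `W.HasCM` and before `W.analyticRank = 1`. [cite: DokchitserDokchitserMathZ2012, Thm. (1)]
[cite: SilvermanATAEC1994, IV.9.4 and Table 4.1] [cite: Rizzo2003, Table II (p. 4)] [cite: AbbesUllmo1996, Thm. A] -/
theorem habitat_of_model_of_odd [W.IsGloballyMinimal] [NeZero (W.conductorNorm ℤ)]
    (hAU : abbesUllmo_not_dvd_maninConstant_of_not_dvd_level) (hodd : Odd n)
    (hcf : ∀ p : ℕ, p.Prime → ¬ (p : ℤ) ^ 3 ∣ n) (h9 : ¬ (n % 9 = 2 ∨ n % 9 = 7))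
    {C : VariableChange ℚ} (hC : C • cubeSumCurve (n : ℚ) = W)
    (hopt : ∃ Dt : ModularParametrizationData W (W.conductorNorm ℤ), ShuZhai2021.IsOptimalDatum W Dt) :
    W.HasCM ∧ (CMInert W 2 ∧ W.HasSurjectiveModNGaloisRep (2 : ℤ) ∧ Odd W.tamagawaProduct ∧
      ∃ Dt : ModularParametrizationData W (W.conductorNorm ℤ),
        (∀ z ∈ Dt.L.lattice, ∃ w ∈ periodLattice Dt.f, z = (Dt.c : ℂ) * w) ∧ Odd Dt.c) := by
  obtain ⟨hCM, hin, hs, ht⟩ := arithmeticHabitat_of_model_of_odd W hodd hcf h9 hC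
  exact ⟨hCM, hin, hs, ht, maninBinder_of_model_of_odd W hAU hodd hC hopt⟩

end Summit.BirchSwinnertonDyer.Rank1Residual.P2.CubeSum

end
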